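import Summits.QuantumFields.BalabanUV.Beta.FP.SecondVarKernelLaw
import Summits.QuantumFields.BalabanUV.Beta.FP.GradedPackedHess

/-!
# `BalabanUV.Beta.FP.KernelDoorLegCurrency` — road «FP» for binder row D1, ROUTE T, junction (J-b) COMPOSED (memo `N2B-DESIGN.md` §30 (30b)+(30c), TID § F.8 STEPS 1–2):
# **THE (STEP) DOOR FOR EVERY WEIGHT IS A LAW OF `hessT`-KERNELS ON THE PACKED LEGS** — #20 `SecondVarKernelLaw` §5 ∘ #22 `GradedPackedHess` §3, one theorem

WHAT.  `hessT_kernel_law_of_secondVar_law_graded`: the hypotheses of `SecondVarKernelLaw.mixedVar_kernel_law_of_secondVar_law_graded` (three graded zero-slice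
bordered systems with per-bond tables, the door along every weight `r : σ → ℝ`) PLUS right inverses `N₀·X_N = 1`, `F₀·X_F = 1`, `G₀·X_G = 1` ⟹ for every bond
pair `(a,b)`: `hessT (X_N packed) v_N(a) v_N(b) w_N(a,b) = hessT (X_F packed) v_F(a) v_F(b) w_F(a,b) + hessT (X_G packed) v_G(a) v_G(b) w_G(a,b)` with the PACKED
GRADED vertices `v_X(a) = [[K_a, −Q_aᵀ],[Q_a, 0]]`, `w_X(a,b) = kkt K_ab Q_ab` and `hessT L V V′ W = ½(tr(L·W) − tr(L·V·(L·V′)))` (road BF-x TA4) — the finite-index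
twin of `ExpKernelCalculus.hessKer` on the packed sorts `ν ⊕ κ` (= `Idx M (Fib d)`, sites × (fields ⊕ multipliers), where the END's `KInvStep Lc j` lives).  For a
sliced system the leg is `[[Γ, I_{·κ}],[L_{κ·}, −S₁₁]]` by `CompositionSingular.kktInv_eq_fromBlocks` (`(kkt H Q)⁻¹ = fromBlocks Γ I L (−S)`; note the SIGN of the
multiplier corner).  What remains for the (T-ID) assembly after this file is NAMING ONLY ((B2): legs = leaf-05's `RelInvPeriodisedComb*` perF-kernels — W-leaf05-g30-5's
socket map —, vertices = `perF (dper tables)`) and the limits ((P2″) W-FP-21-5, #23 `KernelLawDeperiodised`).  [folklore]; no `def`, no `def … : Prop`, nothing cited,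
0 sorry; 0 estimates.

HONEST DEPENDENCY (page 1, mandatory): continuum YM on T⁴ ⇐ BetaPertH ∧ nine spine estimates (0/9 proved); BetaPertH ⇐ (D1) ∧ (D4) ∧ CAP+tail;
G-an2-4 gates asym, D1 and NE2/3/4.  HONEST FRAMING (cell contract, verbatim): «discharging `BetaPertH` makes Bałaban's UV stability UNCONDITIONAL —
a real constructive-QFT result; it is NOT the continuum limit and NOT the Clay problem.»  ABSOLUTE RULE (cell charter, verbatim): «No internally-minted
statement may enter as a cited fact. Every hypothesis is either kernel-proved in this package or a verbatim quotation of a PUBLISHED theorem with page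
reference. The manuscript(s) under audit are NOT citable for their own disputed steps — they are the thing under adjudication; programme-internal
(2001/route/tribunal) claims are never citable.»  Nothing of Bałaban's asserted; 0∕4 row-D1 binders; NOT (T-ID), NOT SDF, NOT D1, NOT BetaPertH, NOT continuum,
NOT Clay.  Road «FP» OWNER, b2b-balaban-beta-d1-p3 gen 21, 2026-08-22.  No existing file touched.
-/

noncomputable section

open scoped BigOperators Matrix

namespace Summit.QuantumFields.BalabanUV.Beta.FP.KernelDoorLegCurrency

open Matrix
open Literature.MathematicalPhysics.QuantumFieldTheory.Balaban1983to89.Beta.Composition (kkt)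
open Summit.QuantumFields.BalabanUV.Beta.D1BFx.LogDetSecondVariation (secondVar)
open Summit.QuantumFields.BalabanUV.Beta.D1BFx.MixedVarPackedHess (hessT)
open Summit.QuantumFields.BalabanUV.Beta.FP.SecondVarKernelLaw (mixedVar_kernel_law_of_secondVar_law_graded)
open Summit.QuantumFields.BalabanUV.Beta.FP.GradedPackedHess (mixedVar_signTwist_fromRows_zero_of_mul_eq_one)

section LegCurrency

variable {ν₁ κ₁ ρ₁ ν₂ κ₂ ρ₂ ν₃ κ₃ ρ₃ σ : Type*}
  [Fintype ν₁] [Fintype κ₁] [Fintype ρ₁] [DecidableEq ν₁] [DecidableEq κ₁] [DecidableEq ρ₁]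
  [Fintype ν₂] [Fintype κ₂] [Fintype ρ₂] [DecidableEq ν₂] [DecidableEq κ₂] [DecidableEq ρ₂]
  [Fintype ν₃] [Fintype κ₃] [Fintype ρ₃] [DecidableEq ν₃] [DecidableEq κ₃] [DecidableEq ρ₃]
  [Fintype σ] [DecidableEq σ]

/-- [folklore] **THE (STEP) DOOR FOR EVERY WEIGHT IS A LAW OF `hessT`-KERNELS ON THE PACKED LEGS** (TID § F.8 STEPS 1–2 in one call): the door along every
weight `r : σ → ℝ` for three graded zero-slice bordered systems with per-bond tables (order-2 families symmetric — free by `sum_sum_smul_symmetrise`), and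
right inverses of the three base matrices ⟹ for every bond pair the `½·(tadpole − bubble)` kernels of the PACKED legs against the PACKED GRADED vertices add. -/
theorem hessT_kernel_law_of_secondVar_law_graded
    (N₀ : Matrix (ν₁ ⊕ (κ₁ ⊕ ρ₁)) (ν₁ ⊕ (κ₁ ⊕ ρ₁)) ℝ) (N₁ : σ → Matrix ν₁ ν₁ ℝ) (N₂ : σ → σ → Matrix ν₁ ν₁ ℝ)
    (M₁ : σ → Matrix κ₁ ν₁ ℝ) (M₂ : σ → σ → Matrix κ₁ ν₁ ℝ)
    (F₀ : Matrix (ν₂ ⊕ (κ₂ ⊕ ρ₂)) (ν₂ ⊕ (κ₂ ⊕ ρ₂)) ℝ) (F₁ : σ → Matrix ν₂ ν₂ ℝ) (F₂ : σ → σ → Matrix ν₂ ν₂ ℝ)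
    (E₁ : σ → Matrix κ₂ ν₂ ℝ) (E₂ : σ → σ → Matrix κ₂ ν₂ ℝ)
    (G₀ : Matrix (ν₃ ⊕ (κ₃ ⊕ ρ₃)) (ν₃ ⊕ (κ₃ ⊕ ρ₃)) ℝ) (G₁ : σ → Matrix ν₃ ν₃ ℝ) (G₂ : σ → σ → Matrix ν₃ ν₃ ℝ)
    (R₁ : σ → Matrix κ₃ ν₃ ℝ) (R₂ : σ → σ → Matrix κ₃ ν₃ ℝ)
    (hN₂ : ∀ k l, N₂ k l = N₂ l k) (hM₂ : ∀ k l, M₂ k l = M₂ l k) (hF₂ : ∀ k l, F₂ k l = F₂ l k) (hE₂ : ∀ k l, E₂ k l = E₂ l k)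
    (hG₂ : ∀ k l, G₂ k l = G₂ l k) (hR₂ : ∀ k l, R₂ k l = R₂ l k)
    (hlaw : ∀ r : σ → ℝ,
      secondVar N₀
          (fromBlocks (∑ k, r k • N₁ k) (-(fromRows (∑ k, r k • M₁ k) (0 : Matrix ρ₁ ν₁ ℝ))ᵀ) (fromRows (∑ k, r k • M₁ k) (0 : Matrix ρ₁ ν₁ ℝ)) 0)
          (kkt (∑ k, ∑ l, (r k * r l) • N₂ k l) (fromRows (∑ k, ∑ l, (r k * r l) • M₂ k l) (0 : Matrix ρ₁ ν₁ ℝ)))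
        = secondVar F₀
            (fromBlocks (∑ k, r k • F₁ k) (-(fromRows (∑ k, r k • E₁ k) (0 : Matrix ρ₂ ν₂ ℝ))ᵀ) (fromRows (∑ k, r k • E₁ k) (0 : Matrix ρ₂ ν₂ ℝ)) 0)
            (kkt (∑ k, ∑ l, (r k * r l) • F₂ k l) (fromRows (∑ k, ∑ l, (r k * r l) • E₂ k l) (0 : Matrix ρ₂ ν₂ ℝ)))
          + secondVar G₀
            (fromBlocks (∑ k, r k • G₁ k) (-(fromRows (∑ k, r k • R₁ k) (0 : Matrix ρ₃ ν₃ ℝ))ᵀ) (fromRows (∑ k, r k • R₁ k) (0 : Matrix ρ₃ ν₃ ℝ)) 0)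
            (kkt (∑ k, ∑ l, (r k * r l) • G₂ k l) (fromRows (∑ k, ∑ l, (r k * r l) • R₂ k l) (0 : Matrix ρ₃ ν₃ ℝ))))
    -- right inverses of the three base matrices (the packed `(ν ⊕ κ)` blocks are the LEGS — `CompositionSingular.kktInv_eq_fromBlocks`:
    -- `(kkt H Q)⁻¹ = fromBlocks Γ I L (−S)`, so the leg is `[[Γ, I_{·κ}],[L_{κ·}, −S₁₁]]` for a sliced system)
    {XN : Matrix (ν₁ ⊕ (κ₁ ⊕ ρ₁)) (ν₁ ⊕ (κ₁ ⊕ ρ₁)) ℝ} (hXN : N₀ * XN = 1)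
    {XF : Matrix (ν₂ ⊕ (κ₂ ⊕ ρ₂)) (ν₂ ⊕ (κ₂ ⊕ ρ₂)) ℝ} (hXF : F₀ * XF = 1)
    {XG : Matrix (ν₃ ⊕ (κ₃ ⊕ ρ₃)) (ν₃ ⊕ (κ₃ ⊕ ρ₃)) ℝ} (hXG : G₀ * XG = 1)
    (a b : σ) :
    hessT (XN.submatrix (Sum.map id Sum.inl) (Sum.map id Sum.inl)) (fromBlocks (N₁ a) (-(M₁ a)ᵀ) (M₁ a) 0) (fromBlocks (N₁ b) (-(M₁ b)ᵀ) (M₁ b) 0)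
        (kkt (N₂ a b) (M₂ a b))
      = hessT (XF.submatrix (Sum.map id Sum.inl) (Sum.map id Sum.inl)) (fromBlocks (F₁ a) (-(E₁ a)ᵀ) (E₁ a) 0) (fromBlocks (F₁ b) (-(E₁ b)ᵀ) (E₁ b) 0)
          (kkt (F₂ a b) (E₂ a b))
        + hessT (XG.submatrix (Sum.map id Sum.inl) (Sum.map id Sum.inl)) (fromBlocks (G₁ a) (-(R₁ a)ᵀ) (R₁ a) 0) (fromBlocks (G₁ b) (-(R₁ b)ᵀ) (R₁ b) 0)
          (kkt (G₂ a b) (R₂ a b)) := by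
  have h := mixedVar_kernel_law_of_secondVar_law_graded N₀ N₁ N₂ M₁ M₂ F₀ F₁ F₂ E₁ E₂ G₀ G₁ G₂ R₁ R₂ hN₂ hM₂ hF₂ hE₂ hG₂ hR₂ hlaw a b
  rw [mixedVar_signTwist_fromRows_zero_of_mul_eq_one hXN, mixedVar_signTwist_fromRows_zero_of_mul_eq_one hXF,
    mixedVar_signTwist_fromRows_zero_of_mul_eq_one hXG] at h
  linarith

end LegCurrency

end Summit.QuantumFields.BalabanUV.Beta.FP.KernelDoorLegCurrency

end
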